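import Literature.MathematicalPhysics.QuantumFieldTheory.Balaban1983to89.Node00.OpsYCoarseBondRep
import Literature.MathematicalPhysics.QuantumFieldTheory.Balaban1983to89.B9Eq3132Ineq2142Covariant
import Literature.MathematicalPhysics.QuantumFieldTheory.Balaban1983to89.B9GeoLemma21KLevelV1
import Literature.MathematicalPhysics.QuantumFieldTheory.Balaban1983to89.B9Eq360DeltaPrimeAY

/-!
# `Balaban1983to89.Node00.OpsYCoarseBondRepFaces` — [B9] (3.13)–(3.16) pp. 392–393 and [4] (2.3) p. 224, (2.45)–(2.46) p. 231 at NODE 00's letters: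
# THE BLOCK FACES OF THE REPRESENTATIVE FINE BOND `repBondY i ι` — its `j`-block is the anchored end-point `base ι`, its `𝔅`-block is the
# carrier block `β ι`, and every fine bond in the support of the averaging kernel `qK i ι ·` ∕ `qsK i · ι` has its `𝔅`-block within graph
# distance `L + 2` of it (dag-n06-c WORD-2, Route L file L-4b `B9SectBQSizesY`: the blockwise-support faces of `QbY ∕ QsbY`)

T. Bałaban, *Propagators for lattice gauge theories in a background field*, Commun. Math. Phys. **99** (1985) 389–434
[Balaban1985BackgroundPropagators], (3.13)–(3.15) pp. 392–393 (`Q_j(U)`, the linear part of the averaging operation), (3.16) p. 393 (`Q*aQ`), p. 397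
(«`y ∈ 𝔅 = ⋃_j Λ_j`, `Δ(y) = B^j(y)`»); *Propagators and renormalization transformations for lattice gauge theories. I*, Commun. Math. Phys. **95** (1984)
17–40 [Balaban1984PropagatorsI], (1.18) p. 20 (`(Q_k A)(b) = Σ_{x ∈ B^k(b₋)} L^{−k(d+1)} A([x, x(b)])`, «`x(b)` is a point in `B^k(b₊)`»); *… II*,
Commun. Math. Phys. **96** (1984) 223–250 [Balaban1984PropagatorsII], (2.3) p. 224 (the bonds `Λ_j` of `𝔅`: one end-point in `Ω_j`, none deep),
(2.45)–(2.46) p. 231 (the block of a bond and the distances between blocks of `𝔅`).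

WHAT THIS FILE PROVES (`i : KIdx` an index of the k-level census, `ι = (j, c) ∈ 𝔅` an index bond, `L = ℓ + 1`; all `theorem`s, no definition).
* §1 ★ `iterBlockOf_repBondY_src`: the `j`-block of the source of NODE 00's representative fine bond `repBondY i ι` (gen 24's anchored representative:
  `⟨embIter j c₋, μ⟩` when `c₋ ∈ Ω_j^{(j)}`, else `⟨embIter j c₊ − e_μ, μ⟩`) IS r03 V1's anchored end-point `base ι` (`c₋` when `c₋ ∈ Ω_j^{(j)}`, else `c₊`
  — the SAME anchoring rule); the target-anchored case rests on the centredness of embedded points (`centred_embIter`: the labels of `embIter j c₊` are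
  `≡ (L−1)/2 (mod L)`, so `L^j ∤` the `μ`-label and the backward step stays in the cornered `j`-block, `iterBlockOf_shift_eq`); ★ `blkY_repBondY_src`: hence
  its block of the multilevel partition is THE CARRIER BLOCK `β ι` (`blkOf_eq_beta`), and `lvl_blkY_repBondY_src` (its level is `j`).
* §2 the support faces, from r03 V1's geometry BY NAME (`ends_of_qwt_ne_zero`: a bond `b` with `qK ι b ≠ 0` starts in the double block `B^j(c₋) ∪ B^j(c₊)`;
  `geomT_dist_ends_le`: every block of `𝔅` met by the double block is within graph distance `ℓ + 3 = L + 2` of `β ι`): ★ `dist_beta_blkY_of_qK_ne_zero`,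
  ★★ `dist_blkY_repBondY_of_qK_ne_zero` (`qK i ι b ≠ 0 ⟹ d_T(𝔅-block of (repBondY i ι)₋, 𝔅-block of b₋) ≤ ℓ + 3`) and the `Q*` twins (`qsK = qKᵀ`,
  `Node00.OpsYDeltaA.qsK_eq_transpose`); and the LABELLED forms in the index-bond geometry `geo9K i` (`dist y y′ = d_T(β y, β y′)`) for ANY block labelling
  `lab : BlkY i → IBondY i` with `β (lab s) = s` (dag-n06-c's `ιB`, `blkC i ιB z = ιB (blkY i z)`): ★★ `geo9K_dist_lab_of_qK_ne_zero` ∕ `…_of_qsK_ne_zero`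
  (dag-n06-c's face (Q1) with **`d₀Q := ℓ + 3`**), ★ `geo9K_dist_self_lab_of_qK_ne_zero` ∕ `…_of_qsK_ne_zero` (read AT the index bond `ι` itself, (Q4)) and
  `geo9K_dist_lab_repBondY_self` (the representative's label is at distance `0` from `ι`).
The companion size faces exist BY NAME and are not restated: `B9Eq3104CommutatorSizesAvg.sum_abs_qK_eq_one` (row sums `= 1`),
`B9Thm310CommutatorBound389B.sum_abs_qsK_le` (column sums `≤ 2`), `B9Eq3104CommutatorSupport.levY_src_bounds_of_qwt_ne_zero` (level window `j − 1 ≤ j(b₋) ≤ j`),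
`Node00.OpsYGauge.aK_eq_diagonal` ∕ `B13BondAveragingReadingNumerals.sum_abs_aK_eq` (the weight `a` is the diagonal of the index's `w`, band `KIdx.hwb`).

[folklore] lattice-torus bookkeeping (`ZMod.val`, divisibility) over landed definitions and r03 V1's typed geometry faces; kernel-checked; no definition,
no `instance`, no `notation`; nothing of NODE 00's ∕ r03's ∕ dag-n06-c's files is modified.  HONEST SCOPE: which fine bond represents an index bond is
OUR convention (gen 24); these faces say the convention is LOCAL in print's block geometry, so that blockwise majorants of `QbY ∕ QsbY ∕ abY` can be read
from those of `QY ∕ QsY` (dag-n06-c's Route L, not done here).  Nothing of [B9]'s estimates is asserted; integer torus; N06 not discharged; not summit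
progress.  Unit `pub-ymgap-node00-def-Y` (gen 25), 2026-08-28.
-/

namespace Literature.MathematicalPhysics.QuantumFieldTheory.Balaban1983to89.Node00

open B6KLevelCensusIndexV1 (KIdx)
open B6GlobalChartV1 (PV domT toBox boxEquiv boxEquiv_apply)
open B6Geom246MultiLevelBox (blkOf)
open B6Geom246MultiLevelTorus (geomT)
open B6Ineq2142KLevelV1 (lvl base β one_le_lvl blkOf_eq_beta beta_level iterBlockOf_shift_eq geomT_dist_ends_le)
open B15DeterminingSets (embIter)
open B5Eq118OneStroke (iterBlockOf iterBlockOf_succ)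
open B9GeoNormsKLevelV1 (geo9K)
open B9GeoLemma21KLevelV1 (one_le_Mh one_le_P one_le_k)
open B9Eq3132Ineq2142Covariant (qK_apply ends_of_qwt_ne_zero two_le_RMh)
open B9Eq360DeltaPrimeAY (blkY)

variable {d ℓ : ℕ} {hd : 1 ≤ d + 1} {hL : Odd (ℓ + 1) ∧ 1 < ℓ + 1} {b₀ b₁ : ℝ}
variable (i : KIdx d ℓ hd hL b₀ b₁)

section Torus

variable {P : Params}

/-- kernel: the embedded point is a section of the block map, `iterBlockOf j (embIter j y) = y` (public homonyms `Node00.OpsYSectELetters.iterBlockOf_embIter`,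
`B9CubeIndexBondsNearH.iterBlockOf_embIter'`, not imported here). [folklore] -/
private theorem iterBlockOf_embIter₀ : ∀ (j : ℕ), j ≤ P.m + P.K → ∀ y : Site P j, iterBlockOf j (embIter j y) = y
  | 0, _, _ => rfl
  | j + 1, hj, y => by
    show blockOf (iterBlockOf j (embIter j (emb y))) = y
    rw [iterBlockOf_embIter₀ j (by omega) (emb y), Site.blockOf_emb hj]

end Torus

/-! ## §1 The representative's blocks: `B^j((repBondY ι)₋) = base ι`, `𝔅`-block `= β ι` -/

section Blocks

/-- ★ **THE `j`-BLOCK OF THE REPRESENTATIVE'S SOURCE IS THE ANCHORED END-POINT `base ι`** (both anchoring cases; the target-anchored one by the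
centredness of `embIter j c₊`: `L^j ∤` its `μ`-label, so `embIter j c₊ − e_μ` lies in the same cornered `j`-block).
[cite: Balaban1984PropagatorsII, (2.3) p.224, (2.45) p.231; Balaban1984PropagatorsI, (1.18) p.20, bookkeeping] -/
theorem iterBlockOf_repBondY_src (ι : IBondY i) :
    iterBlockOf (lvl i.hN i.D i.hk ι) (repBondY i ι).src = base i.hN i.D i.hk ι := by
  have hjm : (ι.1.1 : ℕ) ≤ (PV d ℓ i.m i.K hd hL).m + (PV d ℓ i.m i.K hd hL).K := ibond_level_le i ι
  by_cases h : ι.1.2.src ∈ (domT i.hN i.D i.hk).Om (ι.1.1 : ℕ)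
  · rw [repBondY_of_mem i h]
    show iterBlockOf (ι.1.1 : ℕ) (embIter (ι.1.1 : ℕ) ι.1.2.src) = base i.hN i.D i.hk ι
    rw [base, if_pos h]
    exact iterBlockOf_embIter₀ _ hjm _
  · -- target-anchored: `(repBondY ι)₋ + e_μ = embIter j c₊`, and the step does not cross a `j`-block face
    have hb : base i.hN i.D i.hk ι = ι.1.2.tgt := by rw [base, if_neg h]
    rw [hb]
    have hj1 : 1 ≤ (ι.1.1 : ℕ) := one_le_lvl i.hN i.D i.hk (one_le_k i) ι
    obtain ⟨j, hj⟩ : ∃ j : ℕ, (ι.1.1 : ℕ) = j + 1 := ⟨(ι.1.1 : ℕ) - 1, by omega⟩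
    have hshift : (repBondY i ι).src.shift ι.1.2.dir = embIter (ι.1.1 : ℕ) ι.1.2.tgt := by
      have ht := repBondY_tgt_of_not_mem i h
      rwa [PBond.tgt, repBondY_dir] at ht
    -- the `μ`-label of the embedded point is `≡ (L−1)/2 (mod L)`, hence not divisible by `L^j`
    have hnd : ¬ (ℓ + 1) ^ (ι.1.1 : ℕ) ∣ (((repBondY i ι).src.shift ι.1.2.dir) ι.1.2.dir).val := by
      rw [hshift]
      intro hdvd
      have hc : Centred (embIter (ι.1.1 : ℕ) ι.1.2.tgt) := by
        have hc' := centred_embIter (P := PV d ℓ i.m i.K hd hL) j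
        rw [← hj] at hc'
        exact hc' ι.1.2.tgt hjm
      have hmod := hc ι.1.2.dir
      change ((embIter (ι.1.1 : ℕ) ι.1.2.tgt) ι.1.2.dir).val % (ℓ + 1) = (ℓ + 1 - 1) / 2 at hmod
      have hL1 : (ℓ + 1) ∣ (((embIter (ι.1.1 : ℕ) ι.1.2.tgt) ι.1.2.dir).val) :=
        (dvd_pow_self (ℓ + 1) (by omega)).trans hdvd
      have h0 : ((embIter (ι.1.1 : ℕ) ι.1.2.tgt) ι.1.2.dir).val % (ℓ + 1) = 0 := Nat.mod_eq_zero_of_dvd hL1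
      have hℓ : 4 ≤ ℓ := i.hℓ
      rw [h0] at hmod
      omega
    have hstep := iterBlockOf_shift_eq hjm (repBondY i ι).src ι.1.2.dir hnd
    show iterBlockOf (ι.1.1 : ℕ) (repBondY i ι).src = ι.1.2.tgt
    rw [← hstep, hshift]
    exact iterBlockOf_embIter₀ _ hjm _

/-- ★ **THE `𝔅`-BLOCK OF THE REPRESENTATIVE'S SOURCE IS THE CARRIER BLOCK `β ι`** (the block of `𝔅` containing `B^j(base ι)`).
[cite: Balaban1984PropagatorsII, (2.45) p.231; Balaban1985BackgroundPropagators, p.397 («Δ(y) = B^j(y)»), bookkeeping] -/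
theorem blkY_repBondY_src (ι : IBondY i) : blkY i (boxEquiv i.hN (repBondY i ι).src) = β i.hN i.D i.hk ι :=
  blkOf_eq_beta i.hN i.D i.hk (one_le_k i) ι (iterBlockOf_repBondY_src i ι)

/-- the level of that block is `j(ι)`. [cite: Balaban1984PropagatorsII, (2.45) p.231, bookkeeping] -/
theorem lvl_blkY_repBondY_src (ι : IBondY i) : ((blkY i (boxEquiv i.hN (repBondY i ι).src)).1.1 : ℕ) = lvl i.hN i.D i.hk ι := by
  rw [blkY_repBondY_src]
  exact beta_level i.hN i.D i.hk (one_le_k i) ι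

end Blocks

/-! ## §2 The support of `qK ι ·` ∕ `qsK · ι` lies within graph distance `L + 2` of the carrier block (and of the representative's block) -/

section Support

/-- ★ a fine bond in the support of `qK ι ·` starts in a block of `𝔅` within graph distance `ℓ + 3 = L + 2` of the carrier block `β ι` (r03 V1's
`geomT_dist_ends_le` on the double block `B^j(c₋) ∪ B^j(c₊)` that carries the straight contours of (1.18)).
[cite: Balaban1984PropagatorsI, (1.18) p.20; Balaban1984PropagatorsII, (2.45)–(2.46) p.231; Balaban1985BackgroundPropagators, (3.13)–(3.15) pp.392–393] -/
theorem dist_beta_blkY_of_qK_ne_zero {ι : IBondY i} {b : FBondY i} (h : qK i ι b ≠ 0) :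
    (geomT i.D).dist (β i.hN i.D i.hk ι) (blkY i (boxEquiv i.hN b.src)) ≤ (ℓ : ℝ) + 3 := by
  rw [qK_apply] at h
  exact geomT_dist_ends_le i.hN i.D i.hk (one_le_k i) (two_le_RMh i) (one_le_Mh i) (one_le_P i) ι (ends_of_qwt_ne_zero i h)

/-- ★★ **THE BLOCKWISE-SUPPORT FACE OF `Q`**: `qK i ι b ≠ 0 ⟹ d_T(block of (repBondY i ι)₋, block of b₋) ≤ ℓ + 3` — the entries of the coarse-bond row `ι`,
re-addressed at its representative fine bond (gen 24's `QbY = extBondY ∘ QY`), live in blocks within `L + 2` of the representative's block.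
[cite: Balaban1985BackgroundPropagators, (3.13)–(3.15) pp.392–393; Balaban1984PropagatorsII, (2.45)–(2.46) p.231] -/
theorem dist_blkY_repBondY_of_qK_ne_zero {ι : IBondY i} {b : FBondY i} (h : qK i ι b ≠ 0) :
    (geomT i.D).dist (blkY i (boxEquiv i.hN (repBondY i ι).src)) (blkY i (boxEquiv i.hN b.src)) ≤ (ℓ : ℝ) + 3 := by
  rw [blkY_repBondY_src]
  exact dist_beta_blkY_of_qK_ne_zero i h

/-- the `Q*` twin: `qsK i b ι ≠ 0 ⟹ d_T(β ι, block of b₋) ≤ ℓ + 3` (`qsK = qKᵀ`). [cite: Balaban1985BackgroundPropagators, (3.16) p.393; Balaban1984PropagatorsII, (2.46) p.231] -/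
theorem dist_beta_blkY_of_qsK_ne_zero {ι : IBondY i} {b : FBondY i} (h : qsK i b ι ≠ 0) :
    (geomT i.D).dist (β i.hN i.D i.hk ι) (blkY i (boxEquiv i.hN b.src)) ≤ (ℓ : ℝ) + 3 := by
  rw [qsK_eq_transpose, Matrix.transpose_apply] at h
  exact dist_beta_blkY_of_qK_ne_zero i h

/-- ★★ the `Q*` twin at the representative: `qsK i b ι ≠ 0 ⟹ d_T(block of (repBondY i ι)₋, block of b₋) ≤ ℓ + 3` (gen 24's `QsbY = QsY ∘ resBondY`).
[cite: Balaban1985BackgroundPropagators, (3.16) p.393; Balaban1984PropagatorsII, (2.45)–(2.46) p.231] -/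
theorem dist_blkY_repBondY_of_qsK_ne_zero {ι : IBondY i} {b : FBondY i} (h : qsK i b ι ≠ 0) :
    (geomT i.D).dist (blkY i (boxEquiv i.hN (repBondY i ι).src)) (blkY i (boxEquiv i.hN b.src)) ≤ (ℓ : ℝ) + 3 := by
  rw [qsK_eq_transpose, Matrix.transpose_apply] at h
  exact dist_blkY_repBondY_of_qK_ne_zero i h

/-! ### The labelled forms in the index-bond geometry `geo9K i` (any block labelling `lab` with `β ∘ lab = id`) -/

variable (lab : BlkY i → IBondY i) (hlab : ∀ s : BlkY i, β i.hN i.D i.hk (lab s) = s)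
include hlab

/-- the index-bond geometry reads labelled blocks at their block distance: `(geo9K i).dist (lab s) (lab s′) = d_T(s, s′)`.
[cite: Balaban1985BackgroundPropagators, p.397 (𝔅), dictionary] -/
theorem geo9K_dist_lab_lab (s s' : BlkY i) : (geo9K i).dist (lab s) (lab s') = (geomT i.D).dist s s' := by
  show (geomT i.D).dist (β i.hN i.D i.hk (lab s)) (β i.hN i.D i.hk (lab s')) = _
  rw [hlab, hlab]

/-- … and an index bond against a labelled block: `(geo9K i).dist ι (lab s) = d_T(β ι, s)`. [cite: Balaban1985BackgroundPropagators, p.397 (𝔅), dictionary] -/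
theorem geo9K_dist_self_lab (ι : IBondY i) (s : BlkY i) : (geo9K i).dist ι (lab s) = (geomT i.D).dist (β i.hN i.D i.hk ι) s := by
  show (geomT i.D).dist (β i.hN i.D i.hk ι) (β i.hN i.D i.hk (lab s)) = _
  rw [hlab]

/-- ★★ **dag-n06-c's FACE (Q1), `d₀Q = ℓ + 3`**: `qK i ι b ≠ 0 ⟹ (geo9K i).dist (lab (blkY (repBondY i ι)₋)) (lab (blkY b₋)) ≤ ℓ + 3`.
[cite: Balaban1985BackgroundPropagators, (3.13)–(3.15) pp.392–393; Balaban1984PropagatorsII, (2.45)–(2.46) p.231] -/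
theorem geo9K_dist_lab_of_qK_ne_zero {ι : IBondY i} {b : FBondY i} (h : qK i ι b ≠ 0) :
    (geo9K i).dist (lab (blkY i (boxEquiv i.hN (repBondY i ι).src))) (lab (blkY i (boxEquiv i.hN b.src))) ≤ (ℓ : ℝ) + 3 := by
  rw [geo9K_dist_lab_lab i lab hlab]
  exact dist_blkY_repBondY_of_qK_ne_zero i h

/-- ★★ the `Q*` twin of (Q1): `qsK i b ι ≠ 0 ⟹ (geo9K i).dist (lab (blkY (repBondY i ι)₋)) (lab (blkY b₋)) ≤ ℓ + 3`.
[cite: Balaban1985BackgroundPropagators, (3.16) p.393; Balaban1984PropagatorsII, (2.45)–(2.46) p.231] -/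
theorem geo9K_dist_lab_of_qsK_ne_zero {ι : IBondY i} {b : FBondY i} (h : qsK i b ι ≠ 0) :
    (geo9K i).dist (lab (blkY i (boxEquiv i.hN (repBondY i ι).src))) (lab (blkY i (boxEquiv i.hN b.src))) ≤ (ℓ : ℝ) + 3 := by
  rw [geo9K_dist_lab_lab i lab hlab]
  exact dist_blkY_repBondY_of_qsK_ne_zero i h

/-- ★ (Q4) read AT the index bond: `qK i ι b ≠ 0 ⟹ (geo9K i).dist ι (lab (blkY b₋)) ≤ ℓ + 3`. [cite: Balaban1985BackgroundPropagators, (3.13)–(3.15) pp.392–393; Balaban1984PropagatorsII, (2.46) p.231] -/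
theorem geo9K_dist_self_lab_of_qK_ne_zero {ι : IBondY i} {b : FBondY i} (h : qK i ι b ≠ 0) :
    (geo9K i).dist ι (lab (blkY i (boxEquiv i.hN b.src))) ≤ (ℓ : ℝ) + 3 := by
  rw [geo9K_dist_self_lab i lab hlab]
  exact dist_beta_blkY_of_qK_ne_zero i h

/-- ★ (Q4), `Q*` twin: `qsK i b ι ≠ 0 ⟹ (geo9K i).dist ι (lab (blkY b₋)) ≤ ℓ + 3`. [cite: Balaban1985BackgroundPropagators, (3.16) p.393; Balaban1984PropagatorsII, (2.46) p.231] -/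
theorem geo9K_dist_self_lab_of_qsK_ne_zero {ι : IBondY i} {b : FBondY i} (h : qsK i b ι ≠ 0) :
    (geo9K i).dist ι (lab (blkY i (boxEquiv i.hN b.src))) ≤ (ℓ : ℝ) + 3 := by
  rw [geo9K_dist_self_lab i lab hlab]
  exact dist_beta_blkY_of_qsK_ne_zero i h

/-- the representative's labelled block is at distance `0` from its index bond: `(geo9K i).dist ι (lab (blkY (repBondY i ι)₋)) = 0`.
[cite: Balaban1984PropagatorsII, (2.45) p.231, bookkeeping] -/
theorem geo9K_dist_lab_repBondY_self (ι : IBondY i) : (geo9K i).dist ι (lab (blkY i (boxEquiv i.hN (repBondY i ι).src))) = 0 := by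
  rw [geo9K_dist_self_lab i lab hlab, blkY_repBondY_src]
  show (((B6Geom246MultiLevelTorus.bondT i.D).dist (β i.hN i.D i.hk ι) (β i.hN i.D i.hk ι) : ℕ) : ℝ) = 0
  rw [SimpleGraph.dist_self, Nat.cast_zero]

end Support

end Literature.MathematicalPhysics.QuantumFieldTheory.Balaban1983to89.Node00
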